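import Mathlib
import Literature.Computability.Complexity.SeparationComplexityProofs
import Summits.PneNP.PneNP.Theorems.ConvexRankGatesConvexGateBlindSparseBarrier

set_option linter.dupNamespace false

/-!
# PneNP / ConvexRankGates — `ConvexGateBlind`: the sparse-negative barrier, now unconditional

Helpers (`--supports stmt-PneNP-10680`). `ConvexRankGatesConvexGateBlindSparseBarrier.lean` proved,
CONDITIONALLY on Hrubeš's Theorem 3 (hypothesis `hT3`, verbatim the named fact
`Literature.Computability.Complexity.hrubes_separation_rank_bound`), that hardness of the canonical
clique-distance matrix on its SPARSE rows (negatives with fewer than `C(k,2)` edges) already gives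
super-polynomial `B2`-circuit lower bounds for `CLIQUE(m, ⌈m^δ⌉₊)` and hence `PneNP`. The fact is
now discharged (`hrubes_separation_rank_bound_holds`, `SeparationComplexityProofs.lean`), so both
statements hold outright: a lower-bound line for the crux `ConvexGateBlind` that draws its hardness
only from sparse negatives IS a proof of `NP ⊄ P/poly` — the route's meta-barrier, kernel-checked
with no hypothesis left. [Hrubeš 2020, Thm. 3]
-/

namespace Summit.PneNP.PneNP.Theorems

open Finset Filter Literature.Computability.Complexity

/-- **Sparse-negative hardness of the canonical matrix forces super-polynomial `B2` circuits for
CLIQUE — unconditionally** (`cliqueB2Hard_of_sparseCanonicalHard` with Hrubeš's Theorem 3 supplied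
by `hrubes_separation_rank_bound_holds`). [Hrubeš 2020, Thm. 3] -/
theorem cliqueB2Hard_of_sparseCanonicalHard_unconditional
    (hS : ∃ δ : ℝ, 0 < δ ∧ δ < 1 / 2 ∧ ∀ c : ℕ, ∀ᶠ m : ℕ in atTop, ∀ ε : ℝ, 0 < ε →
      ∀ r : ℕ, r ≤ m ^ c →
        ∀ (a : ((⊤ : SimpleGraph (Fin m)).edgeSet → Bool) → Fin r → ℝ)
          (b : Finset (Fin m) → Fin r → ℝ),
          (∀ u : (⊤ : SimpleGraph (Fin m)).edgeSet → Bool,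
            (univ.filter fun e => u e = true).card < (⌈(m : ℝ) ^ δ⌉₊).choose 2 → ∀ i, 0 ≤ a u i) →
          (∀ Q : Finset (Fin m), Q.card = ⌈(m : ℝ) ^ δ⌉₊ → ∀ i, 0 ≤ b Q i) →
          ¬ ∀ (Q : Finset (Fin m)) (u : (⊤ : SimpleGraph (Fin m)).edgeSet → Bool),
              Q.card = ⌈(m : ℝ) ^ δ⌉₊ →
              (univ.filter fun e => u e = true).card < (⌈(m : ℝ) ^ δ⌉₊).choose 2 →
                ∑ e, (if u e then (0 : ℝ) else 1) * (if cliqueVec Q e then (1 : ℝ) else 0) - ε =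
                  ∑ i, a u i * b Q i) :
    ∃ δ : ℝ, 0 < δ ∧ δ < 1 / 2 ∧ ∀ c : ℕ, ∀ᶠ m : ℕ in atTop,
      ∀ C : Circuit ((⊤ : SimpleGraph (Fin m)).edgeSet), C.IsOver B2 → C.size ≤ m ^ c →
        ¬ C.Computes (cliqueFn m ⌈(m : ℝ) ^ δ⌉₊) :=
  cliqueB2Hard_of_sparseCanonicalHard hrubes_separation_rank_bound_holds hS

/-- **The sparse-negative LP sub-case of the crux implies `P ≠ NP` — unconditionally**
(`pneNP_of_sparseCanonicalHard` with Hrubeš's Theorem 3 supplied by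
`hrubes_separation_rank_bound_holds`): feasible lines on `ConvexGateBlind` must use dense negatives.
[Hrubeš 2020, Thm. 3] -/
theorem pneNP_of_sparseCanonicalHard_unconditional :
    (∃ δ : ℝ, 0 < δ ∧ δ < 1 / 2 ∧ ∀ c : ℕ, ∀ᶠ m : ℕ in atTop, ∀ ε : ℝ, 0 < ε → ∀ r : ℕ, r ≤ m ^ c → ∀ (a : ((⊤ : SimpleGraph (Fin m)).edgeSet → Bool) → Fin r → ℝ) (b : Finset (Fin m) → Fin r → ℝ), (∀ u : (⊤ : SimpleGraph (Fin m)).edgeSet → Bool, (Finset.univ.filter fun e => u e = true).card < (⌈(m : ℝ) ^ δ⌉₊).choose 2 → ∀ i, 0 ≤ a u i) → (∀ Q : Finset (Fin m), Q.card = ⌈(m : ℝ) ^ δ⌉₊ → ∀ i, 0 ≤ b Q i) → ¬ ∀ (Q : Finset (Fin m)) (u : (⊤ : SimpleGraph (Fin m)).edgeSet → Bool), Q.card = ⌈(m : ℝ) ^ δ⌉₊ → (Finset.univ.filter fun e => u e = true).card < (⌈(m : ℝ) ^ δ⌉₊).choose 2 → ∑ e, (if u e then (0 : ℝ) else 1)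 * (if cliqueVec Q e then (1 : ℝ) else 0) - ε = ∑ i, a u i * b Q i) → PneNP :=
  fun hS => pneNP_of_sparseCanonicalHard hrubes_separation_rank_bound_holds hS

end Summit.PneNP.PneNP.Theorems
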